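import Literature.MathematicalPhysics.QuantumFieldTheory.Balaban1983to89.B4Lemma22ZeroBoxDimOne

/-!
# `Balaban1983to89.B4Eq220CommutatorZeroBox` — THE OPERATOR `K_j` OF (2.10) AT ZERO FIELD ON A BOX: FOR b04's BOX
# OPERATOR `H = H_k(□) = n²(−Δ^{η,N}_□) + m² + aQ*_kQ_k` AND A REAL `h` ON `□`, THE COMMUTATOR `K_h = hH − Hh` HAS THE
# PRINTED LEIBNIZ FORM (BOND GRADIENT × BOND DERIVATIVE + NEUMANN LAPLACIAN × VALUE + BLOCK TERM) AND SATISFIES THE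
# ONE-CUBE PARAMETRIX IDENTITY `H(hG(hf)) = h²f − K_hG(hf)` OF (2.9); AND — THE REDUCTION BEHIND (2.20)/(2.21) — IF
# `|h| ≤ 1`, `|∂^ηh| ≤ δ₁`, `|Δ^{η,N}_□h| ≤ δ₂`, `osc_{B(y)}h ≤ δ₃`, EVERY LEMMA 2.2 BOUND `‖Y‖_{q,p} ≤ c₂` FOR
# `Y ∈ {G_k(□,0), D^η_μG_k(□,0)}` GIVES `‖K_hG_k(□,0)h‖_{q,p} ≤ c₂(2(d+1)δ₁ + δ₂ + aδ₃)`; WITH NODES 15/19/24 THE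
# FACTOR BOUND IS UNCONDITIONAL ON THE DIAGONAL `p = q`, ON THE PRINTED PARALLELOGRAM (`p₁ > d + 1`), AND ON THE
# WHOLE TRIANGLE `p ≤ q` OVER `ηℤ¹`

**Source.** T. Bałaban, *Regularity and Decay of Lattice Green's Functions*, Commun. Math. Phys. **89**, 571–597
(1983) (bib key `Balaban1983RegularityDecay`, «B4»): p. 575 [PDF 5] the partition of unity `h_j`; p. 576 [PDF 6]
(2.5)–(2.11); p. 577 [PDF 7] the smallness remark before (2.12); p. 578 [PDF 8] Lemma 2.2 (2.17) and
(2.20)–(2.21); p. 579 [PDF 9] the operator-norm notation (journal page = PDF page + 570).  Quoted from the page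
renders `b2b-balaban-ref1/pages/1983-cmp89-regularity-decay/1983-cmp89-regularity-decay-p005-x4.png`,
`…-p006-x2.png`, `…-p007-x4.png`, `…-p008-x2.png` (read as images; the OCR transcript `b2b-balaban-b04/transcript-B4.md`
agrees); the print's `≦` is written `≤`.

## WHAT IS PRINTED (verbatim from the renders)

p. 575: «Next let us define a partition of unity {h_j}_{j∈Z^d} on T_η. For each j ∈ Z^d, we take
h_j(x) = Π_{μ=1}^d h_{j_μ}(x_μ), and functions h_j(x), j ∈ Z, of one real variable x are defined as
h_j(x) = h(x/M − j), h ∈ C₀^∞(]−2/3, 2/3[), h(x) = 1 for x ∈ [−1/3, 1/3], and it is chosen in such a way that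
Σ_{j∈Z} h_j² = 1.»

p. 576: «(2.5) (−Δ^{η,N}_{A,Ω}hφ)(x) = (−Δ^{η,N}_Ω h)(x)φ(x) − Σ_{b∈st(x), b⊂Ω} (∂^ηh)(b)(D^η_Aφ)(b) +
h(x)(−Δ^{η,N}_{A,Ω}φ)(x).»;
after (2.7): «where we have used the fact that the normal derivative of h_j to the boundary of □_j is equal to
0.»; «(2.8) (P_k(A)hφ)(x) = h(x)(P_k(A)φ)(x) + Σ_{x'∈B^k(y^k(x))} η^d
U(A(Γ^{(k)}_{x,y^k(x),x'}))(∂^ηh)(Γ^{(k)}_{x,y^k(x),x'})φ(x')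
=: h(x)(P_k(A)φ)(x) + (R_k(A,∂^ηh)φ)(x).»; the second line of (2.9): «= δ^η(x−x') − Σ_j
[Σ_{b∈st(x)}(∂^ηh_j)(b)(D^η_{Ã_j}G_k(□_j,Ã_j))(b,x')h_j(x')
+ (Δ^ηh_j)(x)G_k(□_j,Ã_j;x,x')h_j(x') − (R_k(Ã_j,∂^ηh_j)G_k(□_j,Ã_j))(x,x')h_j(x')].»; «Let us define the
operators (2.10) (K_jφ)(x) = □_j(x)[Σ_{b∈st(x)}(∂^ηh_j)(b)(D^η_{Ã_j}φ)(b) + (Δ^ηh_j)(x)φ(x) − Σ_{x'∈B^k(y^k(x))}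
η^d(∂^ηh_j)(Γ^{(k)}_{x,y^k(x),x'})U(Ã_j(Γ^{(k)}_{x,y^k(x),x'}))φ(x')],»
«(2.11) R = Σ_j K_j G_k(□_j,Ã_j)h_j.»

p. 577: «In the sequel we will see that R is a small operator in reasonable norms because |∂^ηh_j| ≤ O(M^{−1}),
|Δ^ηh_j| ≤ O(M^{−2}), so we have the representations (2.12) G_k(Ω,A) = G₀(I − R)^{−1} = Σ_{n=0}^∞ G₀R^n.»

p. 578, Lemma 2.2: «(2.17) ‖G_k(□,Ã)f‖_q, ‖D^η_{Ã,μ}G_k(□,Ã)f‖_q, ‖G_k(□,Ã)D^{η*}_{Ã,μ}f‖_q ≤ c₂‖f‖_p for 1 ≤ p, q ≤ ∞,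
satisfying the condition 1/p − 1/p₁ ≤ 1/q ≤ 1/p with p₁ > d.»; and the use made of it: «We estimate the first sum
using Lemma 2.2 by (2.20) Σ'_{ω:n≤n₀} c₁‖K_{ω₁}G_k(□_{ω₁},Ã_{ω₁})h_{ω₁}‖_∞ · … ·
‖K_{ω_n}G_k(□_{ω_n},Ã_{ω_n})h_{ω_n}‖_∞ ‖f‖_∞
≤ Σ'_{ω:n≤n₀} c₁(c₂O(1)M^{−1})^n ‖f‖_∞. We apply Lemma 2.2 to the terms of the second sum also, more exactly we
apply (2.17) with 1/p₁ = 1/(2n₀) and we fix n₀ such that p₁ = 2n₀ > d + 1, e.g. n₀ = d. We estimate the second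
sum by (2.21) Σ'_{ω:n>n₀} c₁‖K_{ω₁}G_k(□_{ω₁},Ã_{ω₁})h_{ω₁}‖_{∞,p₁} Π_{i=2}^{n₀}
‖K_{ω_i}G_k(□_{ω_i},Ã_{ω_i})h_{ω_i}‖_{p₁/(i−1), p₁/i}
· Π_{i=n₀+1}^{n} ‖K_{ω_i}G_k(□_{ω_i},Ã_{ω_i})h_{ω_i}‖_{2,2} ‖f‖₂ ≤ Σ'_{ω:n>n₀} c₁(c₂O(1)M^{−1})^n ‖f‖_∞.»;
p. 579: «Here ‖T‖_{q,p} denotes a norm of an operator T : L^p → L^q.»  As everywhere in the lineage the print's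
`d` is the number of lattice dimensions = this package's `d + 1` (`Fin (d+1) → ℤ`).

## WHAT IS CERTIFIED (HONEST SCOPE)

The zero-field, one-box, scalar case of the operator `K_j` and of the factor bound that (2.20)/(2.21) take from
Lemma 2.2.  Setting (lattice units, as in nodes 15–24): mesh `n = L^k = η^{-1}` sites per unit length, the box
`□ = Π_μ[0, nM_μ)` of b04's `boxDom` (`M : Fin (d+1) → ℕ` = the box sides in UNIT blocks — not the print's
large-block size `M`, which enters below only through the sizes `δ`), `H = boxOpR n a m² M = n²(−Δ^{η,N}_□) + m² +
(a/n^{d+1})·1[blk · = blk ·]` — b04's real form of the operator (1.6) at `A = 0` (`B4BoxCov237`) — and `G = G_k(□,0) =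
H⁻¹` (a genuine inverse for `a > 0`, `m² ≥ 0`: `boxOpR_mul_inv`; `= (toZFC i).green a` by node 15's `green_eq_box`).

* `opK`, `opK_eq_commutator` — `K_hφ := h·(Hφ) − H(hφ)`, i.e. `K_h = [diag h, H]`, the scalar zero-field instance of
  b04's `B4Commutators25to211.opK … h = mulH h * H − H * mulH h` (there over arbitrary finite site sets, link
  variables and transporters; here concretely on the box, where norms are available).
* `opK_apply` — THE LEIBNIZ FORM (2.10) AT `Ã = 0`: `(K_hφ)(x) = Σ_{y∼x, y∈□}(n(h(y) − h(x)))(n(φ(y) − φ(x)))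
  + (n²Σ_{y∼x, y∈□}(h(y) − h(x)))·φ(x) + (a/n^{d+1})Σ_{y∈B(x)}(h(x) − h(y))φ(y)`: the bond term
  `Σ_{b∈st(x)}(∂^ηh)(b)(D^ηφ)(b)` over the bonds of the star of `x` INSIDE `□` (Neumann), the Laplacian term
  `(Δ^ηh)(x)φ(x)` with the NEUMANN Laplacian of `h` on `□` (what (2.5) produces; the print writes `Δ^η` because
  «the normal derivative of h_j to the boundary of □_j is equal to 0»), and the `P_k`-term of (2.8)/(2.10) at
  `U = 1`, where `(∂^ηh)(Γ_{x,y,x′})`, the sum of `η∂^ηh` along the contour, telescopes to `h(x′) − h(x)` (with the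
  factor `a` of `aP_k`, dropped by the print from (2.9) on); `opK_const` — `K_c = 0` for constant `c`.
* `parametrix_one_cube` — THE `j`-TH TERM OF (2.9): `H(h·G(hf)) = h²f − K_hG(hf)` for every `h`, `f` (`a > 0`,
  `m² ≥ 0`, `n, M_μ ≥ 1`); summed over a partition with `Σ_j h_j² = 1` and the locality (2.6) this is
  `HG₀ = 1 − R`, (2.11) — that summation is b04's `B4Commutators25to211.parametrix_identity` and is not redone.
* `HSize n M h δ₁ δ₂ δ₃` — THE SIZE HYPOTHESES replacing the print's «|∂^ηh_j| ≤ O(M^{−1}), |Δ^ηh_j| ≤ O(M^{−2})»: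
  `|h| ≤ 1`; `n|h(y) − h(x)| ≤ δ₁` on the bonds of `□`; `|n²Σ_{y∼x, y∈□}(h(y) − h(x))| ≤ δ₂` (Neumann Laplacian);
  `|h(x) − h(y)| ≤ δ₃` within a block (`δ₁, δ₂, δ₃ ≥ 0`).  `abs_opK_le` — THE POINTWISE BOUND
  `|K_hφ(x)| ≤ δ₁Σ_μ(|D_μφ(x)| + |D_μφ(x − e_μ)|) + δ₂|φ(x)| + aδ₃·(n^{-(d+1)}Σ_{B(x)}|φ|)` (the `2(d+1)` bonds of the
  star: forward ones are b04's `fdiff`, backward ones its backward shift `bsh`); `lpN_opK_le` — IN b04's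
  `η`-WEIGHTED NORMS `‖·‖_q = ZeroFieldCube.lpN (1/q)`, `1 ≤ q ≤ ∞`:
  `‖K_hφ‖_q ≤ 2δ₁Σ_μ‖D_μφ‖_q + (δ₂ + aδ₃)‖φ‖_q` (Minkowski `lpN_sum_le`; the backward shift and the block
  average of `|φ|` are contractions of every `‖·‖_q`: `lpN_bsh_le`, `lpN_blkAvg_le` — power-mean/Jensen).
* `eq220_zero_box_reduction` — THE REDUCTION: on any member `i : BoxInst d ℓ m²₊` of the zero-field box family
  (`toZFC i`), for `0 ≤ t ≤ s ≤ 1`, IF `‖Y g‖_{1/t} ≤ c₂‖g‖_{1/s}` for the members `Y = opY a 0 μ` (`G`) and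
  `opY a 1 μ` (`D^η_μG`) of (2.17), THEN `‖K_hG(hf)‖_{1/t} ≤ c₂(2(d+1)δ₁ + δ₂ + aδ₃)‖f‖_{1/s}` for every `f` and
  every `h` with `HSize`.  (The third member `GD^{η*}_μ` of (2.17) is not needed for this factor.)
* UNCONDITIONAL COROLLARIES with the lineage's zero-field Lemma 2.2: `eq220_zero_box_diag` — on the diagonal
  `p = q ∈ [1, ∞]`, every dimension (node 15 `lemma22_17_diag_zero_box`), covering the `‖·‖_∞` factors of (2.20)
  and the `‖·‖_{2,2}` factors of (2.21); `eq220_zero_box` — on the printed parallelogram `1/p − 1/p₁ ≤ 1/q ≤ 1/p`,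
  `p₁ > d + 1`, every dimension (node 19 `lemma22_17_zero_box`); `eq220_zero_box_chain` — the exponent pairs
  `(p, q) = (p₁/j, p₁/(j−1))`, `1 ≤ j ≤ p₁`, of the factors `‖·‖_{∞,p₁}`, `‖·‖_{p₁/(i−1), p₁/i}` of (2.21);
  `eq220_zero_box_dimOne` — on the whole triangle `1 ≤ p ≤ q ≤ ∞` over `ηℤ¹` (node 24
  `lemma22_17_zero_box_dimOne`); `eq220_zero_box_Minv` — with `δ₁ = δ₃ = c/M`, `δ₂ = c/M²` (`M ≥ 1` the print's
  large-block size, as a real parameter) the factor is `≤ C(2(d+1) + 1 + a)·c·M^{−1}`: the shape `c₂O(1)M^{−1}` of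
  «c₁(c₂O(1)M^{−1})^n».  ONE constant `C` serves all scales `k ≥ 1`, boxes, masses `m² ∈ [0, m²₊]` and all `h`.

READING (for the carver / `b2b-balaban-template`).  (i) The sizes of `h` are HYPOTHESES here; for the printed
`h_j` (a fixed `C^∞` profile at scale `M` on the unit lattice, `η`-lattice differences) they hold with
`δ₁, δ₃ = O(M^{−1})` (one `η`-bond, resp. one unit block, against a profile varying on scale `M`) and `δ₂ = O(M^{−2})`
for the NEUMANN Laplacian on `□_j` because `h_j` is constant in the normal direction within `M/3` of the faces of
`□_j` lying in `∂Ω` and vanishes near the other faces — the print's normal-derivative remark; this file does not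
construct `h_j` and does not prove these three facts.  (ii) Exponents: `lpN s = ‖·‖_{1/s}`; the print's `‖T‖_{q,p}`
is `L^p → L^q`, i.e. from `s = 1/p` to `t = 1/q`, and (2.17) is used exactly on `0 ≤ t ≤ s ≤ 1`, `s − 1/p₁ ≤ t`.
(iii) The constant is linear in the sizes and otherwise uniform — this is the only quantitative content the
random-walk resummation (2.12)/(2.22) needs from the factors («if M is fixed such that 3^dc₂O(1)M^{−1} ≤ e^{−1}»,
p. 579); b04's abstract chain `B4LpChain221` takes such factor bounds as hypotheses (not instantiated here).

NOT CERTIFIED / NOT CLAIMED: anything at `Ã ≠ 0` (covariant derivatives, `U(Ã(Γ))`); regions `□_j` that are not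
boxes; the construction of the partition of unity and of `Ã_j`; the locality (2.6); the series (2.12), the walk
representation (2.13) and the sums (2.18)–(2.22); the third member of (2.17).  No cited fact is minted; no
hypothesis is assumed beyond the displayed binders; nothing of b04 or of nodes 6–24 is modified.

## ROUTE

Elementary: b04's row formula `opBoxR_mulVec` for `boxOpR` and `boxOpR_mul_inv` (`B4BoxCov237`), its box
neighbour/block sets `boxNbrs`/`boxBlk` (`B4Green242Bridge`) and lattice star `mem_nbrs` (`B4Reflection242`), its
bond difference `fdiff` (`B4Cor23Zero`), the block count `card_filter_blk`; node 15's dictionary `toZFC`/`green_eq_box`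
and `lemma22_17_diag_zero_box`, node 19's `lpN_add_le`/`lpN_bound_mono`/`lemma22_17_zero_box`, node 24's
`lemma22_17_zero_box_dimOne`; Mathlib's weighted power-mean inequality `Real.rpow_arith_mean_le_arith_mean_rpow`
(for the block average) and `abs_add_three`.  §1 is a small toolkit for `lpN` (monotonicity in `|·|`, homogeneity,
finite Minkowski, the two contractions) over a general `ZeroFieldCube`.
-/

namespace Literature.MathematicalPhysics.QuantumFieldTheory.Balaban1983to89.B4Eq220CommutatorZeroBox

open Finset Matrix
open Literature.MathematicalPhysics.QuantumFieldTheory.Balaban1983to89.B4Reflection242 (boxDom mem_boxDom nbrs mem_nbrs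
  blk blk_mem_boxDom)
open Literature.MathematicalPhysics.QuantumFieldTheory.Balaban1983to89.B4Green242Bridge (boxNbrs boxBlk)
open Literature.MathematicalPhysics.QuantumFieldTheory.Balaban1983to89.B4BoxCov237 (boxOpR opBoxR_mulVec boxOpR_mul_inv
  uvec card_filter_blk)
open Literature.MathematicalPhysics.QuantumFieldTheory.Balaban1983to89.B4Cor23Zero (fdiff fdiff_of_mem fdiff_of_not_mem)
open Literature.MathematicalPhysics.QuantumFieldTheory.Balaban1983to89.B4Ineq19ZeroBoxEta (BoxInst)
open Literature.MathematicalPhysics.QuantumFieldTheory.Balaban1983to89.B4Lemma21Zero (ZeroFieldCube)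
open Literature.MathematicalPhysics.QuantumFieldTheory.Balaban1983to89.B4Lemma22ZeroBoxCube (toZFC toZFC_n green_eq_box
  supN_le_of_forall lemma22_17_diag_zero_box)
open Literature.MathematicalPhysics.QuantumFieldTheory.Balaban1983to89.B4Lemma22ZeroBoxLpLq (lpN_nonneg lpN_add_le
  lpN_bound_mono supN_nonneg_cube abs_le_supN_cube rpow_inv_rpow' lemma22_17_zero_box)
open Literature.MathematicalPhysics.QuantumFieldTheory.Balaban1983to89.B4Lemma22ZeroBoxDimOne (lemma22_17_zero_box_dimOne)

noncomputable section

variable {d : ℕ}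

/-! ## §1 Toolkit for b04's `η`-weighted norms `lpN`: monotonicity, homogeneity, Minkowski for finite sums, the
backward shift and the block average are contractions -/

section Toolkit

variable (i : ZeroFieldCube d)

/-- functions with the same absolute values have the same norms. [folklore] -/
theorem lpN_congr_abs {f g : ↥i.R → ℝ} (h : ∀ x, |f x| = |g x|) (s : ℝ) : i.lpN s f = i.lpN s g := by
  unfold ZeroFieldCube.lpN ZeroFieldCube.supN
  simp only [h]

/-- `‖ |f| ‖_p = ‖f‖_p`. [folklore] -/
theorem lpN_abs (f : ↥i.R → ℝ) (s : ℝ) : i.lpN s (fun x => |f x|) = i.lpN s f :=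
  lpN_congr_abs i (fun x => abs_abs (f x)) s

/-- MONOTONICITY: `|f| ≤ |g|` pointwise gives `‖f‖_p ≤ ‖g‖_p` (`s = 1/p ≥ 0`). [folklore] -/
theorem lpN_mono_abs {f g : ↥i.R → ℝ} (h : ∀ x, |f x| ≤ |g x|) {s : ℝ} (hs : 0 ≤ s) :
    i.lpN s f ≤ i.lpN s g := by
  rcases hs.eq_or_lt with hs0 | hs0
  · subst hs0
    unfold ZeroFieldCube.lpN
    rw [if_pos rfl, if_pos rfl]
    exact supN_le_of_forall i f (supN_nonneg_cube i g) fun x => (h x).trans (abs_le_supN_cube i g x)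
  · unfold ZeroFieldCube.lpN
    rw [if_neg hs0.ne', if_neg hs0.ne']
    have hw : 0 ≤ ((1 : ℝ) / i.n) ^ (d + 1) := by positivity
    have hp : 0 ≤ 1 / s := (div_pos one_pos hs0).le
    refine Real.rpow_le_rpow (mul_nonneg hw (Finset.sum_nonneg fun x _ => Real.rpow_nonneg (abs_nonneg _) _))
      (mul_le_mul_of_nonneg_left (Finset.sum_le_sum fun x _ => ?_) hw) hs0.le
    exact Real.rpow_le_rpow (abs_nonneg _) (h x) hp

/-- the zero function has norm `0`. [folklore] -/
theorem lpN_zero_fun (s : ℝ) : i.lpN s (fun _ => (0 : ℝ)) = 0 := by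
  unfold ZeroFieldCube.lpN
  split_ifs with hs
  · unfold ZeroFieldCube.supN
    split_ifs with hne
    · simp
    · rfl
  · simp only [abs_zero, Real.zero_rpow (one_div_ne_zero hs), Finset.sum_const_zero, mul_zero, Real.zero_rpow hs]

/-- HOMOGENEITY (as an inequality, all that is used): `‖c·f‖_p ≤ |c|·‖f‖_p` (`s = 1/p ≥ 0`). [folklore] -/
theorem lpN_const_mul_le (c : ℝ) (f : ↥i.R → ℝ) {s : ℝ} (hs : 0 ≤ s) :
    i.lpN s (fun x => c * f x) ≤ |c| * i.lpN s f := by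
  rcases hs.eq_or_lt with hs0 | hs0
  · subst hs0
    unfold ZeroFieldCube.lpN
    rw [if_pos rfl, if_pos rfl]
    refine supN_le_of_forall i _ (mul_nonneg (abs_nonneg c) (supN_nonneg_cube i f)) fun x => ?_
    rw [abs_mul]
    exact mul_le_mul_of_nonneg_left (abs_le_supN_cube i f x) (abs_nonneg c)
  · unfold ZeroFieldCube.lpN
    rw [if_neg hs0.ne', if_neg hs0.ne']
    have hw : 0 ≤ ((1 : ℝ) / i.n) ^ (d + 1) := by positivity
    have hF : 0 ≤ ∑ x, |f x| ^ (1 / s) := Finset.sum_nonneg fun x _ => Real.rpow_nonneg (abs_nonneg _) _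
    have hpt : ∀ x, |c * f x| ^ (1 / s) = |c| ^ (1 / s) * |f x| ^ (1 / s) := fun x => by
      rw [abs_mul, Real.mul_rpow (abs_nonneg c) (abs_nonneg _)]
    simp_rw [hpt]
    rw [← Finset.mul_sum, mul_left_comm, Real.mul_rpow (Real.rpow_nonneg (abs_nonneg c) _) (mul_nonneg hw hF),
      rpow_inv_rpow' (abs_nonneg c) hs0.ne']

/-- MINKOWSKI (node 19 `lpN_add_le`) for the pointwise sum written as a lambda. [folklore] -/
theorem lpN_add_le' (f g : ↥i.R → ℝ) {s : ℝ} (hs0 : 0 ≤ s) (hs1 : s ≤ 1) :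
    i.lpN s (fun x => f x + g x) ≤ i.lpN s f + i.lpN s g :=
  lpN_add_le i f g hs0 hs1

/-- MINKOWSKI FOR FINITE SUMS: `‖Σ_μ F_μ‖_p ≤ Σ_μ ‖F_μ‖_p` (`p = 1/s ∈ [1, ∞]`). [folklore] -/
theorem lpN_sum_le {ι : Type*} (S : Finset ι) (F : ι → ↥i.R → ℝ) {s : ℝ} (hs0 : 0 ≤ s) (hs1 : s ≤ 1) :
    i.lpN s (fun x => ∑ μ ∈ S, F μ x) ≤ ∑ μ ∈ S, i.lpN s (F μ) := by
  classical
  refine Finset.induction_on S ?_ ?_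
  · simp only [Finset.sum_empty]
    exact (lpN_zero_fun i s).le
  · intro a S ha ih
    simp only [Finset.sum_insert ha]
    exact (lpN_add_le' i _ _ hs0 hs1).trans (add_le_add le_rfl ih)

/-- a sum over the sites of a region of a quantity supported where the position equals a fixed lattice point `c`:
the value at `c` if `c` is a site of the region, `0` otherwise. [folklore] -/
theorem sum_ite_val (R : Finset (Fin (d + 1) → ℤ)) (c : Fin (d + 1) → ℤ) (G : ↥R → ℝ) :
    (∑ y : ↥R, if y.1 = c then G y else 0) = if h : c ∈ R then G ⟨c, h⟩ else 0 := by
  by_cases hc : c ∈ R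
  · rw [dif_pos hc]
    have hiff : ∀ y : ↥R, (y.1 = c) = (y = ⟨c, hc⟩) := fun y =>
      propext ⟨fun h => Subtype.ext h, fun h => by rw [h]⟩
    simp_rw [hiff]
    rw [Finset.sum_ite_eq', if_pos (Finset.mem_univ _)]
  · rw [dif_neg hc]
    exact Finset.sum_eq_zero fun y _ => if_neg fun (h : y.1 = c) => hc (h ▸ y.2)

/-- **THE BACKWARD SHIFT WITH NEUMANN CUT-OFF** along `μ` on a region `R`: `(S_μ g)(x) = g(x − e_μ)` if `x − e_μ ∈ R`,
`0` otherwise (the backward bonds `⟨x − ηe_μ, x⟩ ⊂ □` of the star `st(x)` of (2.5)/(2.10) are the forward bonds of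
`x − ηe_μ`). [folklore] -/
def bsh (R : Finset (Fin (d + 1) → ℤ)) (μ : Fin (d + 1)) (g : ↥R → ℝ) (x : ↥R) : ℝ :=
  if h : x.1 - uvec μ ∈ R then g ⟨x.1 - uvec μ, h⟩ else 0

/-- the shift in the bond case. [folklore] -/
theorem bsh_of_mem {R : Finset (Fin (d + 1) → ℤ)} (μ : Fin (d + 1)) (g : ↥R → ℝ) {x : ↥R}
    (h : x.1 - uvec μ ∈ R) : bsh R μ g x = g ⟨x.1 - uvec μ, h⟩ := by
  unfold bsh
  rw [dif_pos h]

/-- the shift off the bonds. [folklore] -/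
theorem bsh_of_not_mem {R : Finset (Fin (d + 1) → ℤ)} (μ : Fin (d + 1)) (g : ↥R → ℝ) {x : ↥R}
    (h : x.1 - uvec μ ∉ R) : bsh R μ g x = 0 := by
  unfold bsh
  rw [dif_neg h]

/-- `|S_μ g(x)|^p ≤ Σ_z [z + e_μ = x]·|g z|^p`. [folklore] -/
theorem abs_bsh_rpow_le (R : Finset (Fin (d + 1) → ℤ)) (μ : Fin (d + 1)) (g : ↥R → ℝ) (x : ↥R) {p : ℝ}
    (hp : 0 < p) : |bsh R μ g x| ^ p ≤ ∑ z : ↥R, if z.1 + uvec μ = x.1 then |g z| ^ p else 0 := by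
  have h0 : ∀ z : ↥R, 0 ≤ (if z.1 + uvec μ = x.1 then |g z| ^ p else 0) := fun z => by
    split_ifs
    · exact Real.rpow_nonneg (abs_nonneg _) _
    · exact le_rfl
  by_cases h : x.1 - uvec μ ∈ R
  · rw [bsh_of_mem μ g h]
    have hz : (⟨x.1 - uvec μ, h⟩ : ↥R).1 + uvec μ = x.1 := sub_add_cancel _ _
    calc |g ⟨x.1 - uvec μ, h⟩| ^ p
        = (if (⟨x.1 - uvec μ, h⟩ : ↥R).1 + uvec μ = x.1 then |g ⟨x.1 - uvec μ, h⟩| ^ p else 0) := by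
          rw [if_pos hz]
      _ ≤ ∑ z : ↥R, if z.1 + uvec μ = x.1 then |g z| ^ p else 0 :=
          Finset.single_le_sum (fun z _ => h0 z) (Finset.mem_univ _)
  · rw [bsh_of_not_mem μ g h, abs_zero, Real.zero_rpow hp.ne']
    exact Finset.sum_nonneg fun z _ => h0 z

/-- at most one site `x` of the region has `z + e_μ = x`. [folklore] -/
theorem sum_ite_shift_le (R : Finset (Fin (d + 1) → ℤ)) (μ : Fin (d + 1)) (G : ↥R → ℝ) (hG : ∀ z, 0 ≤ G z)
    (z : ↥R) : (∑ x : ↥R, if z.1 + uvec μ = x.1 then G z else 0) ≤ G z := by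
  have hsw : ∀ x : ↥R, (if z.1 + uvec μ = x.1 then G z else 0) = if x.1 = z.1 + uvec μ then G z else 0 :=
    fun x => by simp only [eq_comm]
  simp_rw [hsw]
  rw [sum_ite_val R (z.1 + uvec μ) (fun _ => G z)]
  split_ifs
  · exact le_rfl
  · exact hG z

/-- `Σ_x |S_μ g(x)|^p ≤ Σ_z |g z|^p`. [folklore] -/
theorem sum_abs_bsh_rpow_le (R : Finset (Fin (d + 1) → ℤ)) (μ : Fin (d + 1)) (g : ↥R → ℝ) {p : ℝ}
    (hp : 0 < p) : ∑ x : ↥R, |bsh R μ g x| ^ p ≤ ∑ z : ↥R, |g z| ^ p :=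
  calc ∑ x : ↥R, |bsh R μ g x| ^ p
      ≤ ∑ x : ↥R, ∑ z : ↥R, if z.1 + uvec μ = x.1 then |g z| ^ p else 0 :=
        Finset.sum_le_sum fun x _ => abs_bsh_rpow_le R μ g x hp
    _ = ∑ z : ↥R, ∑ x : ↥R, if z.1 + uvec μ = x.1 then |g z| ^ p else 0 := Finset.sum_comm
    _ ≤ ∑ z : ↥R, |g z| ^ p :=
        Finset.sum_le_sum fun z _ => sum_ite_shift_le R μ (fun z => |g z| ^ p)
          (fun _ => Real.rpow_nonneg (abs_nonneg _) _) z

/-- `|S_μ g(x)| ≤ ‖g‖_∞`. [folklore] -/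
theorem abs_bsh_le_supN (μ : Fin (d + 1)) (g : ↥i.R → ℝ) (x : ↥i.R) : |bsh i.R μ g x| ≤ i.supN g := by
  by_cases h : x.1 - uvec μ ∈ i.R
  · rw [bsh_of_mem μ g h]
    exact abs_le_supN_cube i g _
  · rw [bsh_of_not_mem μ g h, abs_zero]
    exact supN_nonneg_cube i g

/-- **THE BACKWARD SHIFT IS A CONTRACTION** of every `‖·‖_p`, `p = 1/s ∈ [1, ∞]`. [folklore] -/
theorem lpN_bsh_le (μ : Fin (d + 1)) (g : ↥i.R → ℝ) {s : ℝ} (hs : 0 ≤ s) :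
    i.lpN s (bsh i.R μ g) ≤ i.lpN s g := by
  rcases hs.eq_or_lt with hs0 | hs0
  · subst hs0
    unfold ZeroFieldCube.lpN
    rw [if_pos rfl, if_pos rfl]
    exact supN_le_of_forall i _ (supN_nonneg_cube i g) (abs_bsh_le_supN i μ g)
  · unfold ZeroFieldCube.lpN
    rw [if_neg hs0.ne', if_neg hs0.ne']
    have hw : 0 ≤ ((1 : ℝ) / i.n) ^ (d + 1) := by positivity
    exact Real.rpow_le_rpow (mul_nonneg hw (Finset.sum_nonneg fun x _ => Real.rpow_nonneg (abs_nonneg _) _))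
      (mul_le_mul_of_nonneg_left (sum_abs_bsh_rpow_le i.R μ g (div_pos one_pos hs0)) hw) hs0.le

/-- **THE BLOCK AVERAGE OF THE ABSOLUTE VALUE** on a region `R` with block size `b`:
`(Q_b|g|)(x) = b^{−(d+1)} Σ_{y ∈ R, blk y = blk x} |g y|` — the kernel `η^{d+1}·1_{B^k(y^k(x))}` of the `P_k` term of
(2.8)/(2.10) applied to `|g|`. [folklore] -/
def blkAvg (b : ℕ) (R : Finset (Fin (d + 1) → ℤ)) (g : ↥R → ℝ) (x : ↥R) : ℝ :=
  (((b : ℝ) ^ (d + 1))⁻¹) * ∑ y ∈ Finset.univ.filter (fun y : ↥R => blk b y.1 = blk b x.1), |g y|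

/-- the block average is nonnegative. [folklore] -/
theorem blkAvg_nonneg (b : ℕ) (R : Finset (Fin (d + 1) → ℤ)) (g : ↥R → ℝ) (x : ↥R) : 0 ≤ blkAvg b R g x :=
  mul_nonneg (inv_nonneg.mpr (by positivity)) (Finset.sum_nonneg fun y _ => abs_nonneg _)

/-- JENSEN ON A FULL BLOCK: if the block of `x` in `R` has exactly `b^{d+1}` sites, `(Q_b|g|)(x)^p ≤ (Q_b|g|^p)(x)`
for `p ≥ 1`. [folklore] -/
theorem blkAvg_rpow_le (b : ℕ) (R : Finset (Fin (d + 1) → ℤ)) (g : ↥R → ℝ) (x : ↥R)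
    (hcard : (Finset.univ.filter (fun y : ↥R => blk b y.1 = blk b x.1)).card = b ^ (d + 1)) {p : ℝ}
    (hp : 1 ≤ p) :
    (blkAvg b R g x) ^ p
      ≤ (((b : ℝ) ^ (d + 1))⁻¹) * ∑ y ∈ Finset.univ.filter (fun y : ↥R => blk b y.1 = blk b x.1), |g y| ^ p := by
  have hKpos : (0 : ℝ) < (b : ℝ) ^ (d + 1) := by
    have h1 : 0 < b ^ (d + 1) := by
      rw [← hcard]
      exact Finset.card_pos.mpr ⟨x, by simp⟩
    exact_mod_cast h1
  unfold blkAvg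
  rw [Finset.mul_sum, Finset.mul_sum]
  refine Real.rpow_arith_mean_le_arith_mean_rpow _ _ _ (fun y _ => inv_nonneg.mpr hKpos.le) ?_
    (fun y _ => abs_nonneg _) hp
  rw [Finset.sum_const, hcard, nsmul_eq_mul]
  push_cast
  exact mul_inv_cancel₀ hKpos.ne'

/-- SWAPPING A BLOCK DOUBLE SUM: `Σ_x Σ_{y: blk y = blk x} G(y) = Σ_y #{x : blk y = blk x}·G(y)`. [folklore] -/
theorem sum_blk_swap (b : ℕ) (R : Finset (Fin (d + 1) → ℤ)) (G : ↥R → ℝ) :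
    (∑ x : ↥R, ∑ y ∈ Finset.univ.filter (fun y : ↥R => blk b y.1 = blk b x.1), G y)
      = ∑ y : ↥R, ((Finset.univ.filter (fun x : ↥R => blk b y.1 = blk b x.1)).card : ℝ) * G y := by
  simp_rw [Finset.sum_filter]
  rw [Finset.sum_comm]
  refine Finset.sum_congr rfl fun y _ => ?_
  rw [← Finset.sum_filter, Finset.sum_const, nsmul_eq_mul]

/-- `|(Q_b|g|)(x)| ≤ ‖g‖_∞` on full blocks. [folklore] -/
theorem blkAvg_le_supN (b : ℕ) (g : ↥i.R → ℝ) (x : ↥i.R)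
    (hcard : (Finset.univ.filter (fun y : ↥i.R => blk b y.1 = blk b x.1)).card = b ^ (d + 1)) :
    |blkAvg b i.R g x| ≤ i.supN g := by
  have hKpos : (0 : ℝ) < (b : ℝ) ^ (d + 1) := by
    have h1 : 0 < b ^ (d + 1) := by
      rw [← hcard]
      exact Finset.card_pos.mpr ⟨x, by simp⟩
    exact_mod_cast h1
  rw [abs_of_nonneg (blkAvg_nonneg b i.R g x)]
  unfold blkAvg
  calc (((b : ℝ) ^ (d + 1))⁻¹) * ∑ y ∈ Finset.univ.filter (fun y : ↥i.R => blk b y.1 = blk b x.1), |g y|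
      ≤ (((b : ℝ) ^ (d + 1))⁻¹) * ∑ y ∈ Finset.univ.filter (fun y : ↥i.R => blk b y.1 = blk b x.1), i.supN g :=
        mul_le_mul_of_nonneg_left (Finset.sum_le_sum fun y _ => abs_le_supN_cube i g y) (inv_nonneg.mpr hKpos.le)
    _ = i.supN g := by
        rw [Finset.sum_const, hcard, nsmul_eq_mul]
        push_cast
        rw [← mul_assoc, inv_mul_cancel₀ hKpos.ne', one_mul]

/-- **THE BLOCK AVERAGE IS A CONTRACTION** of every `‖·‖_p`, `p = 1/s ∈ [1, ∞]`, on a region whose blocks are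
full (`b^{d+1}` sites each). [folklore] -/
theorem lpN_blkAvg_le (b : ℕ) (g : ↥i.R → ℝ)
    (hcard : ∀ x : ↥i.R, (Finset.univ.filter (fun y : ↥i.R => blk b y.1 = blk b x.1)).card = b ^ (d + 1))
    {s : ℝ} (hs0 : 0 ≤ s) (hs1 : s ≤ 1) : i.lpN s (blkAvg b i.R g) ≤ i.lpN s g := by
  rcases hs0.eq_or_lt with hs | hs
  · subst hs
    unfold ZeroFieldCube.lpN
    rw [if_pos rfl, if_pos rfl]
    exact supN_le_of_forall i _ (supN_nonneg_cube i g) fun x => blkAvg_le_supN i b g x (hcard x)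
  · unfold ZeroFieldCube.lpN
    rw [if_neg hs.ne', if_neg hs.ne']
    have hw : 0 ≤ ((1 : ℝ) / i.n) ^ (d + 1) := by positivity
    have hp : 1 ≤ 1 / s := one_le_one_div hs hs1
    refine Real.rpow_le_rpow (mul_nonneg hw (Finset.sum_nonneg fun x _ => Real.rpow_nonneg (abs_nonneg _) _))
      (mul_le_mul_of_nonneg_left ?_ hw) hs.le
    have hcard' : ∀ y : ↥i.R,
        ((Finset.univ.filter (fun x : ↥i.R => blk b y.1 = blk b x.1)).card : ℝ) = (b : ℝ) ^ (d + 1) := by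
      intro y
      rw [Finset.filter_congr (fun x _ => eq_comm), hcard y]
      push_cast
      rfl
    calc ∑ x, |blkAvg b i.R g x| ^ (1 / s)
        ≤ ∑ x, (((b : ℝ) ^ (d + 1))⁻¹) *
            ∑ y ∈ Finset.univ.filter (fun y : ↥i.R => blk b y.1 = blk b x.1), |g y| ^ (1 / s) :=
          Finset.sum_le_sum fun x _ => by
            rw [abs_of_nonneg (blkAvg_nonneg b i.R g x)]
            exact blkAvg_rpow_le b i.R g x (hcard x) hp
      _ = (((b : ℝ) ^ (d + 1))⁻¹) * ∑ y, ((Finset.univ.filter (fun x : ↥i.R => blk b y.1 = blk b x.1)).card : ℝ)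
            * |g y| ^ (1 / s) := by
          rw [← Finset.mul_sum, sum_blk_swap]
      _ = ∑ y, |g y| ^ (1 / s) := by
          simp_rw [hcard']
          rw [← Finset.mul_sum, ← mul_assoc]
          rcases (Finset.univ : Finset ↥i.R).eq_empty_or_nonempty with h0 | ⟨x, -⟩
          · rw [h0]
            simp
          · have hKpos : (0 : ℝ) < (b : ℝ) ^ (d + 1) := by
              have h1 : 0 < b ^ (d + 1) := by
                rw [← hcard x]
                exact Finset.card_pos.mpr ⟨x, by simp⟩
              exact_mod_cast h1
            rw [inv_mul_cancel₀ hKpos.ne', one_mul]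

end Toolkit

/-! ## §2 The commutator `K_h = [h, H_k(□)]` of b04's box operator with a multiplication operator: the Leibniz form
(2.10) at zero field and the one-cube parametrix identity (2.9) -/

section Commutator

variable {n : ℕ} {a m2 : ℝ} {M : Fin (d + 1) → ℕ}

/-- b04's box operator applied to a vector (`B4BoxCov237.opBoxR_mulVec` read for `boxOpR`):
`(Hv)(x) = n²Σ_{y∼x, y∈□}(v(x) − v(y)) + m²v(x) + (a/n^{d+1})Σ_{y∈B(x)} v(y)` — `n²(−Δ^{η,N}_□) + m² + aQ*_kQ_k` in
lattice units, `η = 1/n`. [cite: Balaban1983RegularityDecay, (1.6) p. 572 with (1.3)–(1.5), case A = 0, dictionary] -/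
theorem boxOpR_mulVec_apply (n : ℕ) (a m2 : ℝ) (M : Fin (d + 1) → ℕ) (v : ↥(boxDom fun j => n * M j) → ℝ)
    (x : ↥(boxDom fun j => n * M j)) :
    (boxOpR n a m2 M *ᵥ v) x = (n : ℝ) ^ 2 * ∑ y ∈ boxNbrs (fun j => n * M j) x, (v x - v y)
      + (m2 * v x + a * ((n : ℝ) ^ (d + 1))⁻¹ * ∑ y ∈ boxBlk n (fun j => n * M j) x, v y) := by
  rw [boxOpR, opBoxR_mulVec]

/-- **THE COMMUTATOR `K_h`** of the zero-field box operator `H = H_k(□) = n²(−Δ^{η,N}_□) + m² + aQ*_kQ_k` (b04's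
`boxOpR n a m² M` on the box `□ = Π_μ[0, nM_μ)`) with the multiplication by a real function `h` on `□`:
`K_h φ = h·(Hφ) − H(hφ)`, i.e. `K_h = [h, H] = hH − Hh` — b04's `B4Commutators25to211.opK H h = mulH h * H − H * mulH h`
in the scalar case, the operator `K_j` of (2.10) for `h = h_j`, `□ = □_j`, `Ã_j = 0`.
[cite: Balaban1983RegularityDecay, (2.10) p. 576, case Ã = 0, scalar, dictionary] -/
def opK (n : ℕ) (a m2 : ℝ) (M : Fin (d + 1) → ℕ) (h φ : ↥(boxDom fun j => n * M j) → ℝ) :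
    ↥(boxDom fun j => n * M j) → ℝ :=
  fun x => h x * (boxOpR n a m2 M *ᵥ φ) x - (boxOpR n a m2 M *ᵥ fun y => h y * φ y) x

/-- the definition of `K_h`, pointwise. [folklore] -/
theorem opK_def (h φ : ↥(boxDom fun j => n * M j) → ℝ) (x : ↥(boxDom fun j => n * M j)) :
    opK n a m2 M h φ x = h x * (boxOpR n a m2 M *ᵥ φ) x - (boxOpR n a m2 M *ᵥ fun y => h y * φ y) x := rfl

/-- `K_h` IS THE MATRIX COMMUTATOR `[diag h, H]` applied to `φ` (b04's `mulH h * H − H * mulH h`). [folklore] -/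
theorem opK_eq_commutator (h φ : ↥(boxDom fun j => n * M j) → ℝ) :
    opK n a m2 M h φ = (Matrix.diagonal h * boxOpR n a m2 M - boxOpR n a m2 M * Matrix.diagonal h) *ᵥ φ := by
  have hd : Matrix.diagonal h *ᵥ φ = fun y => h y * φ y := funext fun y => Matrix.mulVec_diagonal h φ y
  funext x
  rw [opK_def, Matrix.sub_mulVec, ← Matrix.mulVec_mulVec, ← Matrix.mulVec_mulVec, hd, Pi.sub_apply,
    Matrix.mulVec_diagonal]

/-- **THE LEIBNIZ FORM (2.10) OF `K_h` AT ZERO FIELD.**  For every real `h`, `φ` on the box and every site `x`: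
`(K_hφ)(x) = Σ_{y∼x, y∈□} (n(h(y) − h(x)))·(n(φ(y) − φ(x))) + (n²Σ_{y∼x, y∈□}(h(y) − h(x)))·φ(x)
+ (a/n^{d+1})Σ_{y∈B(x)} (h(x) − h(y))φ(y)` — the three printed terms of (2.10): `Σ_{b∈st(x)}(∂^ηh)(b)(D^ηφ)(b)`
(bond gradient of `h` times bond derivative of `φ`, over the `2(d+1)` bonds of the star of `x` inside `□`; both
orientations of a bond give the same product), `(Δ^ηh)(x)φ(x)` with the NEUMANN Laplacian of `h` on `□`
(`(Δ^{η,N}_□h)(x) = n²Σ_{y∼x, y∈□}(h(y) − h(x))`; from (2.5) with `−Δ^{η,N}_Ω`, the print's remark after (2.7) «the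
normal derivative of h_j to the boundary of □_j is equal to 0» being what lets it write `Δ^η`), and the `P_k`-term
`−Σ_{x′∈B^k(y^k(x))} η^d(∂^ηh)(Γ^{(k)}_{x,y^k(x),x′})U(Ã(Γ))φ(x′)` of (2.8) at `Ã = 0`, where the sum of `∂^ηh` along the
contour `Γ_{x,y,x′}` from `x` to `x′` telescopes to `h(x′) − h(x)` (here with the factor `a` of `aP_k`, which the print
drops from (2.9) on, ⟦sic⟧ of the transcript).
[cite: Balaban1983RegularityDecay, (2.10) p. 576 with (2.5), (2.8); case Ã = 0, scalar, □ a box] -/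
theorem opK_apply (h φ : ↥(boxDom fun j => n * M j) → ℝ) (x : ↥(boxDom fun j => n * M j)) :
    opK n a m2 M h φ x
      = ∑ y ∈ boxNbrs (fun j => n * M j) x, ((n : ℝ) * (h y - h x)) * ((n : ℝ) * (φ y - φ x))
        + ((n : ℝ) ^ 2 * ∑ y ∈ boxNbrs (fun j => n * M j) x, (h y - h x)) * φ x
        + a * ((n : ℝ) ^ (d + 1))⁻¹ * ∑ y ∈ boxBlk n (fun j => n * M j) x, (h x - h y) * φ y := by
  rw [opK_def, boxOpR_mulVec_apply, boxOpR_mulVec_apply]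
  have f1 : ∑ y ∈ boxNbrs (fun j => n * M j) x, ((n : ℝ) * (h y - h x)) * ((n : ℝ) * (φ y - φ x))
      + ((n : ℝ) ^ 2 * ∑ y ∈ boxNbrs (fun j => n * M j) x, (h y - h x)) * φ x
      = (n : ℝ) ^ 2 * (h x * ∑ y ∈ boxNbrs (fun j => n * M j) x, (φ x - φ y)
          - ∑ y ∈ boxNbrs (fun j => n * M j) x, (h x * φ x - h y * φ y)) := by
    simp only [Finset.mul_sum, Finset.sum_mul]
    rw [← Finset.sum_add_distrib, ← Finset.sum_sub_distrib, Finset.mul_sum]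
    exact Finset.sum_congr rfl fun y _ => by ring
  have f3 : a * ((n : ℝ) ^ (d + 1))⁻¹ * ∑ y ∈ boxBlk n (fun j => n * M j) x, (h x - h y) * φ y
      = a * ((n : ℝ) ^ (d + 1))⁻¹ * (h x * ∑ y ∈ boxBlk n (fun j => n * M j) x, φ y
          - ∑ y ∈ boxBlk n (fun j => n * M j) x, h y * φ y) := by
    congr 1
    rw [Finset.mul_sum, ← Finset.sum_sub_distrib]
    exact Finset.sum_congr rfl fun y _ => by ring
  rw [f1, f3]
  ring

/-- `K_h` VANISHES FOR CONSTANT `h`: only `∂^ηh`, `Δ^ηh` enter (2.10). [folklore] -/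
theorem opK_const (c : ℝ) (φ : ↥(boxDom fun j => n * M j) → ℝ) : opK n a m2 M (fun _ => c) φ = fun _ => 0 := by
  funext x
  rw [opK_apply]
  simp

/-- **THE PARAMETRIX IDENTITY (2.9) FOR ONE CUBE AT ZERO FIELD.**  With `G = G_k(□,0) = H^{−1}` (b04's
`(boxOpR n a m² M)⁻¹`, a genuine two-sided inverse by `B4BoxCov237.boxOpR_mul_inv`, `a > 0`, `m² ≥ 0`) and any real
`h`, `f` on the box: `H(h·G(hf)) = h²f − K_h G(hf)` — the `j`-th term of (2.9)
`HG₀ = Σ_j h_j(HG_jh_j) − Σ_j K_jG_jh_j = 1 − R` before the sum over `j` and `Σ_j h_j² = 1`.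
[cite: Balaban1983RegularityDecay, (2.9), (2.11) p. 576, case Ã = 0, one cube] -/
theorem parametrix_one_cube (hn : 1 ≤ n) (ha : 0 < a) (hm : 0 ≤ m2) (hM : ∀ j, 1 ≤ M j)
    (h f : ↥(boxDom fun j => n * M j) → ℝ) :
    boxOpR n a m2 M *ᵥ (fun x => h x * ((boxOpR n a m2 M)⁻¹ *ᵥ fun y => h y * f y) x)
      = fun x => h x ^ 2 * f x - opK n a m2 M h ((boxOpR n a m2 M)⁻¹ *ᵥ fun y => h y * f y) x := by
  funext x
  rw [opK_def, Matrix.mulVec_mulVec, boxOpR_mul_inv hn ha hm hM, Matrix.one_mulVec]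
  ring

end Commutator

/-! ## §3 The pointwise bound on `K_hφ`: bond gradient, Neumann Laplacian and block oscillation of `h` -/

section Pointwise

variable {N : Fin (d + 1) → ℕ}

/-- membership in the box star: `y ∼ x` in `ℤ^{d+1}`. [folklore] -/
theorem mem_boxNbrs_iff {x y : ↥(boxDom N)} : y ∈ boxNbrs N x ↔ y.1 ∈ nbrs x.1 := by
  unfold boxNbrs
  simp only [Finset.mem_filter, Finset.mem_univ, true_and]

/-- THE STAR OF A SITE IS COVERED BY ITS `2(d+1)` COORDINATE BONDS: for `F ≥ 0`,
`Σ_{y∼x, y∈□} F(y) ≤ Σ_μ ([x+e_μ ∈ □]F(x+e_μ) + [x−e_μ ∈ □]F(x−e_μ))`. [folklore] -/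
theorem sum_boxNbrs_le (x : ↥(boxDom N)) (F : ↥(boxDom N) → ℝ) (hF : ∀ y, 0 ≤ F y) :
    ∑ y ∈ boxNbrs N x, F y
      ≤ ∑ μ : Fin (d + 1), ((∑ y : ↥(boxDom N), if y.1 = x.1 + uvec μ then F y else 0)
          + ∑ y : ↥(boxDom N), if y.1 = x.1 - uvec μ then F y else 0) := by
  have h0 : ∀ (y : ↥(boxDom N)) (ν : Fin (d + 1)),
      0 ≤ (if y.1 = x.1 + uvec ν then F y else 0) + (if y.1 = x.1 - uvec ν then F y else 0) :=
    fun y ν => add_nonneg (by split_ifs; exacts [hF y, le_rfl]) (by split_ifs; exacts [hF y, le_rfl])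
  have hpt : ∀ y ∈ boxNbrs N x, F y ≤ ∑ μ : Fin (d + 1),
      ((if y.1 = x.1 + uvec μ then F y else 0) + (if y.1 = x.1 - uvec μ then F y else 0)) := by
    intro y hy
    rw [mem_boxNbrs_iff, mem_nbrs] at hy
    obtain ⟨μ, hμ⟩ := hy
    refine le_trans ?_ (Finset.single_le_sum (fun ν _ => h0 y ν) (Finset.mem_univ μ))
    rcases hμ with hμ | hμ
    · have hμ' : y.1 = x.1 + uvec μ := hμ
      rw [if_pos hμ']
      exact le_add_of_nonneg_right (by split_ifs; exacts [hF y, le_rfl])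
    · have hμ' : y.1 = x.1 - uvec μ := hμ
      rw [if_pos hμ']
      exact le_add_of_nonneg_left (by split_ifs; exacts [hF y, le_rfl])
  calc ∑ y ∈ boxNbrs N x, F y
      ≤ ∑ y ∈ boxNbrs N x, ∑ μ : Fin (d + 1),
          ((if y.1 = x.1 + uvec μ then F y else 0) + (if y.1 = x.1 - uvec μ then F y else 0)) :=
        Finset.sum_le_sum hpt
    _ ≤ ∑ y : ↥(boxDom N), ∑ μ : Fin (d + 1),
          ((if y.1 = x.1 + uvec μ then F y else 0) + (if y.1 = x.1 - uvec μ then F y else 0)) :=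
        Finset.sum_le_sum_of_subset_of_nonneg (Finset.subset_univ _)
          fun y _ _ => Finset.sum_nonneg fun ν _ => h0 y ν
    _ = ∑ μ : Fin (d + 1), ∑ y : ↥(boxDom N),
          ((if y.1 = x.1 + uvec μ then F y else 0) + (if y.1 = x.1 - uvec μ then F y else 0)) :=
        Finset.sum_comm
    _ = _ := Finset.sum_congr rfl fun μ _ => Finset.sum_add_distrib

/-- **THE STAR SUM OF BOND DIFFERENCES THROUGH b04's `D_μ` AND THE BACKWARD SHIFT**:
`Σ_{y∼x, y∈□} |n(φ(y) − φ(x))| ≤ Σ_μ (|(D_μφ)(x)| + |(S_μD_μφ)(x)|)` — the forward bond `⟨x, x+ηe_μ⟩` contributes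
`|D_μφ(x)|` (b04's `fdiff`), the backward bond `⟨x−ηe_μ, x⟩` contributes `|D_μφ(x − ηe_μ)| = |(S_μD_μφ)(x)|`.
[folklore] -/
theorem sum_boxNbrs_absDiff_le (n : ℕ) (φ : ↥(boxDom N) → ℝ) (x : ↥(boxDom N)) :
    ∑ y ∈ boxNbrs N x, |(n : ℝ) * (φ y - φ x)|
      ≤ ∑ μ : Fin (d + 1), (|fdiff n (boxDom N) μ φ x| + |bsh (boxDom N) μ (fdiff n (boxDom N) μ φ) x|) := by
  refine (sum_boxNbrs_le x (fun y => |(n : ℝ) * (φ y - φ x)|) fun y => abs_nonneg _).trans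
    (Finset.sum_le_sum fun μ _ => add_le_add ?_ ?_)
  · rw [sum_ite_val (boxDom N) (x.1 + uvec μ) (fun y => |(n : ℝ) * (φ y - φ x)|)]
    split_ifs with h
    · exact le_of_eq (by rw [fdiff_of_mem φ h])
    · exact abs_nonneg _
  · rw [sum_ite_val (boxDom N) (x.1 - uvec μ) (fun y => |(n : ℝ) * (φ y - φ x)|)]
    split_ifs with h
    · have hx : (⟨x.1 - uvec μ, h⟩ : ↥(boxDom N)).1 + uvec μ ∈ boxDom N := by
        rw [sub_add_cancel]
        exact x.2
      have hxe : (⟨(⟨x.1 - uvec μ, h⟩ : ↥(boxDom N)).1 + uvec μ, hx⟩ : ↥(boxDom N)) = x :=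
        Subtype.ext (sub_add_cancel _ _)
      rw [bsh_of_mem μ _ h, fdiff_of_mem φ hx, hxe]
      exact le_of_eq (by
        rw [show (n : ℝ) * (φ ⟨x.1 - uvec μ, h⟩ - φ x) = -((n : ℝ) * (φ x - φ ⟨x.1 - uvec μ, h⟩)) by ring,
          abs_neg])
    · exact abs_nonneg _

/-- b04's block set of the box is the block class of this file's `blkAvg`. [folklore] -/
theorem blkAvg_eq_boxBlk (n : ℕ) (M : Fin (d + 1) → ℕ) (g : ↥(boxDom fun j => n * M j) → ℝ)
    (x : ↥(boxDom fun j => n * M j)) :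
    blkAvg n (boxDom fun j => n * M j) g x
      = ((n : ℝ) ^ (d + 1))⁻¹ * ∑ y ∈ boxBlk n (fun j => n * M j) x, |g y| := rfl

/-- every block of the box `Π_μ[0, nM_μ)` is full: `n^{d+1}` sites (b04's `card_filter_blk`). [folklore] -/
theorem card_blkClass_box {n : ℕ} (hn : 1 ≤ n) (M : Fin (d + 1) → ℕ) (x : ↥(boxDom fun j => n * M j)) :
    (Finset.univ.filter (fun y : ↥(boxDom fun j => n * M j) => blk n y.1 = blk n x.1)).card = n ^ (d + 1) :=
  card_filter_blk hn M ⟨blk n x.1, blk_mem_boxDom hn x.2⟩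

/-- **THE SIZE HYPOTHESES ON THE PARTITION FUNCTION `h` ON THE BOX** (mesh `n`, box `Π_μ[0, nM_μ)`), the three
printed smallness sources of `K_j` with explicit sizes: `|h| ≤ 1`; `|∂^ηh| ≤ δ₁` on the bonds of `□`
(`n|h(y) − h(x)| ≤ δ₁`, `y ∼ x`); `|Δ^{η,N}_□h| ≤ δ₂` (`|n²Σ_{y∼x, y∈□}(h(y) − h(x))| ≤ δ₂` — the NEUMANN Laplacian:
for the print's `h_j`, whose normal derivative vanishes at `∂□_j`, it is `Δ^ηh_j`); and the block oscillation
`|h(x) − h(y)| ≤ δ₃` for `x`, `y` in one block `B^k(y)` (the telescoped `Σ(∂^ηh)(Γ_{x,y,x′})` of (2.8)).  The print: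
«|∂^ηh_j| ≤ O(M^{−1}), |Δ^ηh_j| ≤ O(M^{−2})» (p. 577), so `δ₁, δ₃ = O(M^{−1})`, `δ₂ = O(M^{−2})`.
[cite: Balaban1983RegularityDecay, p. 575 (h_j), p. 577 l. 1–2, dictionary] -/
structure HSize (n : ℕ) (M : Fin (d + 1) → ℕ) (h : ↥(boxDom fun j => n * M j) → ℝ) (δ₁ δ₂ δ₃ : ℝ) : Prop where
  nonneg₁ : 0 ≤ δ₁
  nonneg₂ : 0 ≤ δ₂
  nonneg₃ : 0 ≤ δ₃
  abs_le : ∀ x, |h x| ≤ 1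
  grad_le : ∀ x, ∀ y ∈ boxNbrs (fun j => n * M j) x, (n : ℝ) * |h y - h x| ≤ δ₁
  lap_le : ∀ x, |(n : ℝ) ^ 2 * ∑ y ∈ boxNbrs (fun j => n * M j) x, (h y - h x)| ≤ δ₂
  osc_le : ∀ x, ∀ y ∈ boxBlk n (fun j => n * M j) x, |h x - h y| ≤ δ₃

/-- **THE POINTWISE BOUND ON `K_hφ`**: under the size hypotheses,
`|(K_hφ)(x)| ≤ δ₁Σ_μ(|D_μφ(x)| + |S_μD_μφ(x)|) + δ₂|φ(x)| + aδ₃(Q|φ|)(x)` (`Q|φ|` the block average of `|φ|`).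
[cite: Balaban1983RegularityDecay, (2.10) p. 576 with p. 577 l. 1–2, case Ã = 0, dictionary] -/
theorem abs_opK_le {n : ℕ} {a m2 : ℝ} {M : Fin (d + 1) → ℕ} (ha : 0 ≤ a) {δ₁ δ₂ δ₃ : ℝ}
    {h : ↥(boxDom fun j => n * M j) → ℝ} (hh : HSize n M h δ₁ δ₂ δ₃) (φ : ↥(boxDom fun j => n * M j) → ℝ)
    (x : ↥(boxDom fun j => n * M j)) :
    |opK n a m2 M h φ x|
      ≤ δ₁ * ∑ μ : Fin (d + 1), (|fdiff n (boxDom fun j => n * M j) μ φ x|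
            + |bsh (boxDom fun j => n * M j) μ (fdiff n (boxDom fun j => n * M j) μ φ) x|)
        + δ₂ * |φ x| + a * δ₃ * blkAvg n (boxDom fun j => n * M j) φ x := by
  rw [opK_apply]
  have hK : 0 ≤ ((n : ℝ) ^ (d + 1))⁻¹ := inv_nonneg.mpr (by positivity)
  have B1 : |∑ y ∈ boxNbrs (fun j => n * M j) x, ((n : ℝ) * (h y - h x)) * ((n : ℝ) * (φ y - φ x))|
      ≤ δ₁ * ∑ μ : Fin (d + 1), (|fdiff n (boxDom fun j => n * M j) μ φ x|
            + |bsh (boxDom fun j => n * M j) μ (fdiff n (boxDom fun j => n * M j) μ φ) x|) :=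
    calc |∑ y ∈ boxNbrs (fun j => n * M j) x, ((n : ℝ) * (h y - h x)) * ((n : ℝ) * (φ y - φ x))|
        ≤ ∑ y ∈ boxNbrs (fun j => n * M j) x, |((n : ℝ) * (h y - h x)) * ((n : ℝ) * (φ y - φ x))| :=
          Finset.abs_sum_le_sum_abs _ _
      _ ≤ ∑ y ∈ boxNbrs (fun j => n * M j) x, δ₁ * |(n : ℝ) * (φ y - φ x)| :=
          Finset.sum_le_sum fun y hy => by
            rw [abs_mul]
            refine mul_le_mul_of_nonneg_right ?_ (abs_nonneg _)
            rw [abs_mul, Nat.abs_cast]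
            exact hh.grad_le x y hy
      _ = δ₁ * ∑ y ∈ boxNbrs (fun j => n * M j) x, |(n : ℝ) * (φ y - φ x)| := by rw [Finset.mul_sum]
      _ ≤ _ := mul_le_mul_of_nonneg_left (sum_boxNbrs_absDiff_le n φ x) hh.nonneg₁
  have B2 : |((n : ℝ) ^ 2 * ∑ y ∈ boxNbrs (fun j => n * M j) x, (h y - h x)) * φ x| ≤ δ₂ * |φ x| := by
    rw [abs_mul]
    exact mul_le_mul_of_nonneg_right (hh.lap_le x) (abs_nonneg _)
  have B3 : |a * ((n : ℝ) ^ (d + 1))⁻¹ * ∑ y ∈ boxBlk n (fun j => n * M j) x, (h x - h y) * φ y|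
      ≤ a * δ₃ * blkAvg n (boxDom fun j => n * M j) φ x := by
    rw [blkAvg_eq_boxBlk, abs_mul, abs_of_nonneg (mul_nonneg ha hK)]
    calc a * ((n : ℝ) ^ (d + 1))⁻¹ * |∑ y ∈ boxBlk n (fun j => n * M j) x, (h x - h y) * φ y|
        ≤ a * ((n : ℝ) ^ (d + 1))⁻¹ * ∑ y ∈ boxBlk n (fun j => n * M j) x, δ₃ * |φ y| :=
          mul_le_mul_of_nonneg_left ((Finset.abs_sum_le_sum_abs _ _).trans
            (Finset.sum_le_sum fun y hy => by
              rw [abs_mul]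
              exact mul_le_mul_of_nonneg_right (hh.osc_le x y hy) (abs_nonneg _))) (mul_nonneg ha hK)
      _ = a * δ₃ * (((n : ℝ) ^ (d + 1))⁻¹ * ∑ y ∈ boxBlk n (fun j => n * M j) x, |φ y|) := by
          rw [← Finset.mul_sum]
          ring
  exact (abs_add_three _ _ _).trans (add_le_add (add_le_add B1 B2) B3)

end Pointwise

/-! ## §4 The reduction "Lemma 2.2 (2.17) ⇒ the factor bound of (2.20)/(2.21)" at zero field on a box -/

section Reduction

variable {ℓ : ℕ} {m2plus : ℝ}

/-- b04's first member of (2.17) on the box member `i` is `G_k(□,0)g` (`(toZFC i).green a = (boxOpR L^k a m² M)⁻¹` by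
`B4Lemma22ZeroBoxCube.green_eq_box`). [cite: Balaban1983RegularityDecay, (2.17) p. 578, case Ã = 0, dictionary] -/
theorem opY_zero (a : ℝ) (i : BoxInst d ℓ m2plus) (μ : Fin (d + 1))
    (g : ↥(boxDom fun j => (ℓ + 1) ^ i.k * i.M j) → ℝ) :
    (toZFC i).opY a 0 μ g = (toZFC i).green a *ᵥ g := by
  unfold ZeroFieldCube.opY
  rw [if_pos rfl]

/-- … and the second is `D^η_μG_k(□,0)g`, b04's bond difference `fdiff` of `G_k(□,0)g`.
[cite: Balaban1983RegularityDecay, (2.17) p. 578, case Ã = 0, dictionary] -/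
theorem opY_one (a : ℝ) (i : BoxInst d ℓ m2plus) (μ : Fin (d + 1))
    (g : ↥(boxDom fun j => (ℓ + 1) ^ i.k * i.M j) → ℝ) :
    (toZFC i).opY a 1 μ g
      = fdiff ((ℓ + 1) ^ i.k) (boxDom fun j => (ℓ + 1) ^ i.k * i.M j) μ ((toZFC i).green a *ᵥ g) := by
  unfold ZeroFieldCube.opY
  rw [if_neg (by decide), if_pos rfl]
  rfl

/-- **THE NORM OF `K_hφ` THROUGH THE MEMBERS OF (2.17)** (Minkowski + the two contractions of §1): on the box member
`i` (mesh `n = L^k`), under the size hypotheses on `h`, for `q = 1/t ∈ [1, ∞]`: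
`‖K_hφ‖_q ≤ 2δ₁Σ_μ‖D_μφ‖_q + (δ₂ + aδ₃)‖φ‖_q`.
[cite: Balaban1983RegularityDecay, (2.10) p. 576 with p. 577 l. 1–2, case Ã = 0, dictionary] -/
theorem lpN_opK_le (a : ℝ) (ha : 0 ≤ a) (i : BoxInst d ℓ m2plus) {δ₁ δ₂ δ₃ : ℝ}
    {h : ↥(boxDom fun j => (ℓ + 1) ^ i.k * i.M j) → ℝ} (hh : HSize ((ℓ + 1) ^ i.k) i.M h δ₁ δ₂ δ₃)
    (φ : ↥(boxDom fun j => (ℓ + 1) ^ i.k * i.M j) → ℝ) {t : ℝ} (ht0 : 0 ≤ t) (ht1 : t ≤ 1) :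
    (toZFC i).lpN t (opK ((ℓ + 1) ^ i.k) a i.m2 i.M h φ)
      ≤ 2 * δ₁ * ∑ μ : Fin (d + 1),
          (toZFC i).lpN t (fdiff ((ℓ + 1) ^ i.k) (boxDom fun j => (ℓ + 1) ^ i.k * i.M j) μ φ)
        + (δ₂ + a * δ₃) * (toZFC i).lpN t φ := by
  have hn : 1 ≤ (ℓ + 1) ^ i.k := BoxInst.one_le_Lk ℓ i.k
  -- step 1: the pointwise majorant
  have h1 : (toZFC i).lpN t (opK ((ℓ + 1) ^ i.k) a i.m2 i.M h φ)
      ≤ (toZFC i).lpN t (fun x =>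
          (δ₁ * ∑ μ : Fin (d + 1), (|fdiff ((ℓ + 1) ^ i.k) (boxDom fun j => (ℓ + 1) ^ i.k * i.M j) μ φ x|
              + |bsh (boxDom fun j => (ℓ + 1) ^ i.k * i.M j) μ
                  (fdiff ((ℓ + 1) ^ i.k) (boxDom fun j => (ℓ + 1) ^ i.k * i.M j) μ φ) x|)
            + δ₂ * |φ x|)
          + a * δ₃ * blkAvg ((ℓ + 1) ^ i.k) (boxDom fun j => (ℓ + 1) ^ i.k * i.M j) φ x) :=
    lpN_mono_abs (toZFC i) (fun x => (abs_opK_le ha hh φ x).trans (le_abs_self _)) ht0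
  -- step 2: Minkowski
  have h2 := lpN_add_le' (toZFC i)
    (fun x => δ₁ * ∑ μ : Fin (d + 1), (|fdiff ((ℓ + 1) ^ i.k) (boxDom fun j => (ℓ + 1) ^ i.k * i.M j) μ φ x|
        + |bsh (boxDom fun j => (ℓ + 1) ^ i.k * i.M j) μ
            (fdiff ((ℓ + 1) ^ i.k) (boxDom fun j => (ℓ + 1) ^ i.k * i.M j) μ φ) x|) + δ₂ * |φ x|)
    (fun x => a * δ₃ * blkAvg ((ℓ + 1) ^ i.k) (boxDom fun j => (ℓ + 1) ^ i.k * i.M j) φ x) ht0 ht1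
  have h3 := lpN_add_le' (toZFC i)
    (fun x => δ₁ * ∑ μ : Fin (d + 1), (|fdiff ((ℓ + 1) ^ i.k) (boxDom fun j => (ℓ + 1) ^ i.k * i.M j) μ φ x|
        + |bsh (boxDom fun j => (ℓ + 1) ^ i.k * i.M j) μ
            (fdiff ((ℓ + 1) ^ i.k) (boxDom fun j => (ℓ + 1) ^ i.k * i.M j) μ φ) x|))
    (fun x => δ₂ * |φ x|) ht0 ht1
  -- step 3: the gradient terms
  have h4 : (toZFC i).lpN t (fun x => δ₁ * ∑ μ : Fin (d + 1),
        (|fdiff ((ℓ + 1) ^ i.k) (boxDom fun j => (ℓ + 1) ^ i.k * i.M j) μ φ x|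
          + |bsh (boxDom fun j => (ℓ + 1) ^ i.k * i.M j) μ
              (fdiff ((ℓ + 1) ^ i.k) (boxDom fun j => (ℓ + 1) ^ i.k * i.M j) μ φ) x|))
      ≤ δ₁ * (2 * ∑ μ : Fin (d + 1),
          (toZFC i).lpN t (fdiff ((ℓ + 1) ^ i.k) (boxDom fun j => (ℓ + 1) ^ i.k * i.M j) μ φ)) := by
    refine (lpN_const_mul_le (toZFC i) δ₁ _ ht0).trans ?_
    rw [abs_of_nonneg hh.nonneg₁]
    refine mul_le_mul_of_nonneg_left ?_ hh.nonneg₁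
    refine (lpN_sum_le (toZFC i) Finset.univ (fun μ x =>
      |fdiff ((ℓ + 1) ^ i.k) (boxDom fun j => (ℓ + 1) ^ i.k * i.M j) μ φ x|
        + |bsh (boxDom fun j => (ℓ + 1) ^ i.k * i.M j) μ
            (fdiff ((ℓ + 1) ^ i.k) (boxDom fun j => (ℓ + 1) ^ i.k * i.M j) μ φ) x|) ht0 ht1).trans ?_
    rw [Finset.mul_sum]
    refine Finset.sum_le_sum fun μ _ => ?_
    refine (lpN_add_le' (toZFC i) _ _ ht0 ht1).trans ?_
    rw [lpN_abs, lpN_abs, two_mul]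
    exact add_le_add le_rfl (lpN_bsh_le (toZFC i) μ _ ht0)
  -- step 4: the Laplacian term
  have h5 : (toZFC i).lpN t (fun x => δ₂ * |φ x|) ≤ δ₂ * (toZFC i).lpN t φ := by
    refine (lpN_const_mul_le (toZFC i) δ₂ _ ht0).trans ?_
    rw [abs_of_nonneg hh.nonneg₂, lpN_abs]
  -- step 5: the block term
  have h6 : (toZFC i).lpN t
        (fun x => a * δ₃ * blkAvg ((ℓ + 1) ^ i.k) (boxDom fun j => (ℓ + 1) ^ i.k * i.M j) φ x)
      ≤ a * δ₃ * (toZFC i).lpN t φ := by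
    refine (lpN_const_mul_le (toZFC i) (a * δ₃) _ ht0).trans ?_
    rw [abs_of_nonneg (mul_nonneg ha hh.nonneg₃)]
    exact mul_le_mul_of_nonneg_left
      (lpN_blkAvg_le (toZFC i) ((ℓ + 1) ^ i.k) φ (fun x => card_blkClass_box hn i.M x) ht0 ht1)
      (mul_nonneg ha hh.nonneg₃)
  linarith [h1, h2, h3, h4, h5, h6]

/-- **THE REDUCTION "LEMMA 2.2 ⇒ THE FACTOR BOUND OF (2.20)/(2.21)" AT ZERO FIELD ON A BOX.**  Let `i` be a member
of the zero-field box family (mesh `η = L^{-k}`, box `□ = Π_μ[0, M_μ)`, mass `m² ∈ [0, m²₊]`), `a ≥ 0`,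
`G = G_k(□,0) = (toZFC i).green a` (`= (boxOpR L^k a m² M)⁻¹`, node 15 `green_eq_box`), and let `h` satisfy the size
hypotheses `HSize` with `(δ₁, δ₂, δ₃)`.  IF at
the exponent pair `p = 1/s ≤ q = 1/t` (`0 ≤ t ≤ s ≤ 1`) the members `G_k(□,0)`, `D^η_μG_k(□,0)` of (2.17) obey
`‖Yg‖_q ≤ c₂‖g‖_p` on `□` (b04's `opY`, `lpN`; `c₂ ≥ 0`), THEN the factor of the random-walk expansion obeys
`‖K_h G_k(□,0) h f‖_q ≤ c₂·(2(d+1)δ₁ + δ₂ + aδ₃)·‖f‖_p` — the printed factor bound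
`‖K_{ω_i}G_k(□_{ω_i},Ã_{ω_i})h_{ω_i}‖ ≤ c₂O(1)M^{−1}` of «c₁(c₂O(1)M^{−1})^n» with its `O(1)M^{−1}` made explicit in
the sizes of `h`.  The hypothesis `hY` quantifies over all three members `k : Fin 3` of (2.17) for convenience;
only `k = 0, 1` are used.  HONEST SCOPE: zero field, one box, scalar; the sizes of `h` are hypotheses (no partition
of unity is constructed here).
[cite: Balaban1983RegularityDecay, (2.20)–(2.21) p. 578 with (2.10)–(2.11) p. 576 and Lemma 2.2 (2.17); case Ã = 0, □ a box] -/
theorem eq220_zero_box_reduction (a : ℝ) (ha : 0 ≤ a) (i : BoxInst d ℓ m2plus) {s t c₂ : ℝ} (ht0 : 0 ≤ t)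
    (hts : t ≤ s) (hs1 : s ≤ 1) (hc : 0 ≤ c₂)
    (hY : ∀ (k : Fin 3) (μ : Fin (d + 1)) (g : ↥(boxDom fun j => (ℓ + 1) ^ i.k * i.M j) → ℝ),
      (toZFC i).lpN t ((toZFC i).opY a k μ g) ≤ c₂ * (toZFC i).lpN s g)
    {δ₁ δ₂ δ₃ : ℝ} {h : ↥(boxDom fun j => (ℓ + 1) ^ i.k * i.M j) → ℝ}
    (hh : HSize ((ℓ + 1) ^ i.k) i.M h δ₁ δ₂ δ₃) (f : ↥(boxDom fun j => (ℓ + 1) ^ i.k * i.M j) → ℝ) :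
    (toZFC i).lpN t (opK ((ℓ + 1) ^ i.k) a i.m2 i.M h
        ((toZFC i).green a *ᵥ fun y => h y * f y))
      ≤ c₂ * (2 * ((d : ℝ) + 1) * δ₁ + δ₂ + a * δ₃) * (toZFC i).lpN s f := by
  have ht1 : t ≤ 1 := hts.trans hs1
  have hs0 : 0 ≤ s := ht0.trans hts
  have hhf : (toZFC i).lpN s (fun y => h y * f y) ≤ (toZFC i).lpN s f :=
    lpN_mono_abs (toZFC i) (fun y => by
      rw [abs_mul]
      exact mul_le_of_le_one_left (abs_nonneg _) (hh.abs_le y)) hs0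
  have hG : (toZFC i).lpN t ((toZFC i).green a *ᵥ fun y => h y * f y)
      ≤ c₂ * (toZFC i).lpN s f := by
    have h0 := hY 0 0 (fun y => h y * f y)
    rw [opY_zero] at h0
    exact h0.trans (mul_le_mul_of_nonneg_left hhf hc)
  have hD : ∀ μ : Fin (d + 1), (toZFC i).lpN t (fdiff ((ℓ + 1) ^ i.k) (boxDom fun j => (ℓ + 1) ^ i.k * i.M j) μ
      ((toZFC i).green a *ᵥ fun y => h y * f y)) ≤ c₂ * (toZFC i).lpN s f := fun μ => by
    have h0 := hY 1 μ (fun y => h y * f y)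
    rw [opY_one] at h0
    exact h0.trans (mul_le_mul_of_nonneg_left hhf hc)
  have hsum : ∑ μ : Fin (d + 1), (toZFC i).lpN t (fdiff ((ℓ + 1) ^ i.k)
      (boxDom fun j => (ℓ + 1) ^ i.k * i.M j) μ ((toZFC i).green a *ᵥ fun y => h y * f y))
      ≤ ((d : ℝ) + 1) * (c₂ * (toZFC i).lpN s f) := by
    refine (Finset.sum_le_sum fun μ _ => hD μ).trans ?_
    rw [Finset.sum_const, Finset.card_univ, Fintype.card_fin, nsmul_eq_mul, Nat.cast_add, Nat.cast_one]
  have hA := lpN_opK_le a ha i hh ((toZFC i).green a *ᵥ fun y => h y * f y) ht0 ht1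
  have hδ₁ : 0 ≤ 2 * δ₁ := by linarith [hh.nonneg₁]
  have hδ₂₃ : 0 ≤ δ₂ + a * δ₃ := add_nonneg hh.nonneg₂ (mul_nonneg ha hh.nonneg₃)
  calc _ ≤ _ := hA
    _ ≤ 2 * δ₁ * (((d : ℝ) + 1) * (c₂ * (toZFC i).lpN s f)) + (δ₂ + a * δ₃) * (c₂ * (toZFC i).lpN s f) :=
        add_le_add (mul_le_mul_of_nonneg_left hsum hδ₁) (mul_le_mul_of_nonneg_left hG hδ₂₃)
    _ = c₂ * (2 * ((d : ℝ) + 1) * δ₁ + δ₂ + a * δ₃) * (toZFC i).lpN s f := by ring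

end Reduction

/-! ## §5 Corollaries with the Lemma 2.2 bounds this lineage proved at zero field on boxes -/

section Corollaries

variable {ℓ : ℕ} {m2plus : ℝ}

/-- **THE FACTOR BOUND ON THE DIAGONAL `p = q ∈ [1, ∞]`, EVERY DIMENSION** (node 15
`B4Lemma22ZeroBoxCube.lemma22_17_diag_zero_box`: (2.17) at `p = q`, `Ã = 0`, boxes): one constant `C > 0` for all
scales `k ≥ 1`, boxes, masses `m² ∈ [0, m²₊]` and all `h` of sizes `(δ₁, δ₂, δ₃)`:
`‖K_hG_k(□,0)hf‖_p ≤ C(2(d+1)δ₁ + δ₂ + aδ₃)‖f‖_p` — in particular the `‖·‖_∞` of (2.20) (`s = 0`) and the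
`‖·‖_{2,2}` of (2.21) (`s = 1/2`).
[cite: Balaban1983RegularityDecay, (2.20)–(2.21) p. 578 with (2.10), Lemma 2.2 (2.17) at p = q; case Ã = 0, □ a box] -/
theorem eq220_zero_box_diag (hℓ : 1 ≤ ℓ) (a : ℝ) (ha : 0 < a) :
    ∃ C : ℝ, 0 < C ∧ ∀ (i : BoxInst d ℓ m2plus) (δ₁ δ₂ δ₃ : ℝ)
      (h : ↥(boxDom fun j => (ℓ + 1) ^ i.k * i.M j) → ℝ), HSize ((ℓ + 1) ^ i.k) i.M h δ₁ δ₂ δ₃ →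
      ∀ s : ℝ, 0 ≤ s → s ≤ 1 → ∀ f : ↥(boxDom fun j => (ℓ + 1) ^ i.k * i.M j) → ℝ,
        (toZFC i).lpN s (opK ((ℓ + 1) ^ i.k) a i.m2 i.M h
            ((toZFC i).green a *ᵥ fun y => h y * f y))
          ≤ C * (2 * ((d : ℝ) + 1) * δ₁ + δ₂ + a * δ₃) * (toZFC i).lpN s f := by
  obtain ⟨c₂, hc₂, hY⟩ := lemma22_17_diag_zero_box (d := d) (m2plus := m2plus) hℓ a ha
  exact ⟨c₂, hc₂, fun i δ₁ δ₂ δ₃ h hh s hs0 hs1 f =>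
    eq220_zero_box_reduction a ha.le i hs0 le_rfl hs1 hc₂.le (fun k μ g => hY i k μ g s hs0 hs1) hh f⟩

/-- **THE FACTOR BOUND ON THE PRINTED PARALLELOGRAM `1/p − 1/p₁ ≤ 1/q ≤ 1/p`, `p₁ > d + 1`** (node 19
`B4Lemma22ZeroBoxLpLq.lemma22_17_zero_box`: (2.17) as printed, `Ã = 0`, boxes; the print's «p₁ > d» with its `d` =
the lattice dimension = this package's `d + 1`): one constant `C > 0` with
`‖K_hG_k(□,0)hf‖_q ≤ C(2(d+1)δ₁ + δ₂ + aδ₃)‖f‖_p` for all such `(p, q)` — every factor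
`‖K_{ω_i}G_k(□_{ω_i},Ã_{ω_i})h_{ω_i}‖_{p₁/(i−1), p₁/i}` of (2.21) at zero field.
[cite: Balaban1983RegularityDecay, (2.20)–(2.21) p. 578 with (2.10), Lemma 2.2 (2.17); case Ã = 0, □ a box] -/
theorem eq220_zero_box (hℓ : 1 ≤ ℓ) (a : ℝ) (ha : 0 < a) (p₁ : ℝ) (hp : (d : ℝ) + 1 < p₁) :
    ∃ C : ℝ, 0 < C ∧ ∀ (i : BoxInst d ℓ m2plus) (δ₁ δ₂ δ₃ : ℝ)
      (h : ↥(boxDom fun j => (ℓ + 1) ^ i.k * i.M j) → ℝ), HSize ((ℓ + 1) ^ i.k) i.M h δ₁ δ₂ δ₃ →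
      ∀ s t : ℝ, 0 ≤ t → s ≤ 1 → s - 1 / p₁ ≤ t → t ≤ s →
      ∀ f : ↥(boxDom fun j => (ℓ + 1) ^ i.k * i.M j) → ℝ,
        (toZFC i).lpN t (opK ((ℓ + 1) ^ i.k) a i.m2 i.M h
            ((toZFC i).green a *ᵥ fun y => h y * f y))
          ≤ C * (2 * ((d : ℝ) + 1) * δ₁ + δ₂ + a * δ₃) * (toZFC i).lpN s f := by
  obtain ⟨c₂, hc₂, hY⟩ := lemma22_17_zero_box (d := d) (m2plus := m2plus) hℓ a ha p₁ hp
  exact ⟨c₂, hc₂, fun i δ₁ δ₂ δ₃ h hh s t ht0 hs1 hst hts f =>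
    eq220_zero_box_reduction a ha.le i ht0 hts hs1 hc₂.le (fun k μ g => hY i s t k μ g ht0 hs1 hst hts) hh f⟩

/-- **THE EXPONENT CHAIN OF (2.21)**: with `p₁ > d + 1` fixed, the `j`-th factor maps `L^{p₁/j} → L^{p₁/(j−1)}`
(`1 ≤ j ≤ p₁`; `s = j/p₁`, `t = (j−1)/p₁`, so `1/p − 1/p₁ = 1/q` exactly — the transcript's ⟦exponent bookkeeping⟧ of
(2.21)); at zero field on a box each such factor is bounded by `C(2(d+1)δ₁ + δ₂ + aδ₃)`.
[cite: Balaban1983RegularityDecay, (2.21) p. 578 «we apply (2.17) with 1/p₁ = 1/(2n₀) and we fix n₀ such that p₁ = 2n₀ > d + 1, e.g. n₀ = d»; case Ã = 0, □ a box] -/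
theorem eq220_zero_box_chain (hℓ : 1 ≤ ℓ) (a : ℝ) (ha : 0 < a) (p₁ : ℝ) (hp : (d : ℝ) + 1 < p₁) :
    ∃ C : ℝ, 0 < C ∧ ∀ (i : BoxInst d ℓ m2plus) (δ₁ δ₂ δ₃ : ℝ)
      (h : ↥(boxDom fun j => (ℓ + 1) ^ i.k * i.M j) → ℝ), HSize ((ℓ + 1) ^ i.k) i.M h δ₁ δ₂ δ₃ →
      ∀ j : ℕ, 1 ≤ j → (j : ℝ) ≤ p₁ → ∀ f : ↥(boxDom fun j => (ℓ + 1) ^ i.k * i.M j) → ℝ,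
        (toZFC i).lpN (((j : ℝ) - 1) / p₁) (opK ((ℓ + 1) ^ i.k) a i.m2 i.M h
            ((toZFC i).green a *ᵥ fun y => h y * f y))
          ≤ C * (2 * ((d : ℝ) + 1) * δ₁ + δ₂ + a * δ₃) * (toZFC i).lpN ((j : ℝ) / p₁) f := by
  obtain ⟨C, hC, hK⟩ := eq220_zero_box (d := d) (m2plus := m2plus) hℓ a ha p₁ hp
  have hp0 : 0 < p₁ := lt_of_le_of_lt (by positivity) hp
  refine ⟨C, hC, fun i δ₁ δ₂ δ₃ h hh j hj hjp f => hK i δ₁ δ₂ δ₃ h hh _ _ ?_ ?_ ?_ ?_ f⟩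
  · exact div_nonneg (sub_nonneg.mpr (by exact_mod_cast hj)) hp0.le
  · exact (div_le_one hp0).mpr hjp
  · exact le_of_eq (by ring)
  · exact div_le_div_of_nonneg_right (by linarith) hp0.le

/-- **THE FACTOR BOUND ON THE WHOLE TRIANGLE `1 ≤ p ≤ q ≤ ∞` IN ONE DIMENSION** (node 24
`B4Lemma22ZeroBoxDimOne.lemma22_17_zero_box_dimOne`: on `ηℤ¹` (2.17) needs no condition on `1/p − 1/q`).
[cite: Balaban1983RegularityDecay, (2.20)–(2.21) p. 578 with (2.10), Lemma 2.2 (2.17); case Ã = 0, □ ⊂ ηℤ¹ a box] -/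
theorem eq220_zero_box_dimOne (hℓ : 1 ≤ ℓ) (a : ℝ) (ha : 0 < a) :
    ∃ C : ℝ, 0 < C ∧ ∀ (i : BoxInst 0 ℓ m2plus) (δ₁ δ₂ δ₃ : ℝ)
      (h : ↥(boxDom fun j => (ℓ + 1) ^ i.k * i.M j) → ℝ), HSize ((ℓ + 1) ^ i.k) i.M h δ₁ δ₂ δ₃ →
      ∀ s t : ℝ, 0 ≤ t → t ≤ s → s ≤ 1 →
      ∀ f : ↥(boxDom fun j => (ℓ + 1) ^ i.k * i.M j) → ℝ,
        (toZFC i).lpN t (opK ((ℓ + 1) ^ i.k) a i.m2 i.M h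
            ((toZFC i).green a *ᵥ fun y => h y * f y))
          ≤ C * (2 * δ₁ + δ₂ + a * δ₃) * (toZFC i).lpN s f := by
  obtain ⟨c₂, hc₂, hY⟩ := lemma22_17_zero_box_dimOne (ℓ := ℓ) (m2plus := m2plus) hℓ a ha
  refine ⟨c₂, hc₂, fun i δ₁ δ₂ δ₃ h hh s t ht0 hts hs1 f => ?_⟩
  have h0 := eq220_zero_box_reduction a ha.le i ht0 hts hs1 hc₂.le (fun k μ g => hY i s t k μ g ht0 hs1 hts) hh f
  calc _ ≤ _ := h0
    _ = c₂ * (2 * δ₁ + δ₂ + a * δ₃) * (toZFC i).lpN s f := by push_cast; ring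

/-- the arithmetic of the printed sizes: `|∂^ηh| ≤ c/M`, `|Δ^ηh| ≤ c/M²`, block oscillation `≤ c/M` (`M ≥ 1`) give
`2(d+1)δ₁ + δ₂ + aδ₃ ≤ (2(d+1) + 1 + a)·c·M^{−1}` — the «O(1)M^{−1}» of (2.20). [folklore] -/
theorem sizes_Minv (d : ℕ) {c Mr : ℝ} (a : ℝ) (hM : 1 ≤ Mr) (hc : 0 ≤ c) :
    2 * ((d : ℝ) + 1) * (c / Mr) + c / Mr ^ 2 + a * (c / Mr) ≤ (2 * ((d : ℝ) + 1) + 1 + a) * c / Mr := by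
  have hMpos : 0 < Mr := lt_of_lt_of_le one_pos hM
  have h1 : c / Mr ^ 2 ≤ c / Mr := div_le_div_of_nonneg_left hc hMpos (by nlinarith)
  have h2 : (2 * ((d : ℝ) + 1) + 1 + a) * c / Mr = 2 * ((d : ℝ) + 1) * (c / Mr) + c / Mr + a * (c / Mr) := by
    ring
  rw [h2]
  linarith

/-- **THE PRINTED SHAPE `‖K_{ω_i}G_k(□_{ω_i},Ã_{ω_i})h_{ω_i}‖ ≤ c₂O(1)M^{−1}` AT ZERO FIELD ON A BOX**: for `h` with
`|∂^ηh| ≤ c/M`, `|Δ^{η,N}_□h| ≤ c/M²` and block oscillation `≤ c/M` (`M ≥ 1` real, `c ≥ 0`), on the printed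
parallelogram of exponents, `‖K_hG_k(□,0)hf‖_q ≤ C·(2(d+1) + 1 + a)·c·M^{−1}·‖f‖_p`.
[cite: Balaban1983RegularityDecay, (2.20) p. 578 with p. 577 «|∂^ηh_j| ≤ O(M^{−1}), |Δ^ηh_j| ≤ O(M^{−2})»; case Ã = 0, □ a box] -/
theorem eq220_zero_box_Minv (hℓ : 1 ≤ ℓ) (a : ℝ) (ha : 0 < a) (p₁ : ℝ) (hp : (d : ℝ) + 1 < p₁) :
    ∃ C : ℝ, 0 < C ∧ ∀ (i : BoxInst d ℓ m2plus) (c Mr : ℝ), 0 ≤ c → 1 ≤ Mr →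
      ∀ h : ↥(boxDom fun j => (ℓ + 1) ^ i.k * i.M j) → ℝ,
        HSize ((ℓ + 1) ^ i.k) i.M h (c / Mr) (c / Mr ^ 2) (c / Mr) →
      ∀ s t : ℝ, 0 ≤ t → s ≤ 1 → s - 1 / p₁ ≤ t → t ≤ s →
      ∀ f : ↥(boxDom fun j => (ℓ + 1) ^ i.k * i.M j) → ℝ,
        (toZFC i).lpN t (opK ((ℓ + 1) ^ i.k) a i.m2 i.M h
            ((toZFC i).green a *ᵥ fun y => h y * f y))
          ≤ C * ((2 * ((d : ℝ) + 1) + 1 + a) * c / Mr) * (toZFC i).lpN s f := by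
  obtain ⟨C, hC, hK⟩ := eq220_zero_box (d := d) (m2plus := m2plus) hℓ a ha p₁ hp
  refine ⟨C, hC, fun i c Mr hc hM h hh s t ht0 hs1 hst hts f =>
    (hK i _ _ _ h hh s t ht0 hs1 hst hts f).trans ?_⟩
  exact mul_le_mul_of_nonneg_right (mul_le_mul_of_nonneg_left (sizes_Minv d a hM hc) hC.le)
    (lpN_nonneg _ _ _)

end Corollaries

/-! ## §6 Sanity checks -/

section Sanity

variable {n : ℕ} {a m2 : ℝ} {M : Fin (d + 1) → ℕ}

/-- SANITY: constants commute with `H_k(□)` — `K_c = 0` (no smallness needed; (2.10) has no zeroth-order term in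
`h`). [folklore] -/
example (c : ℝ) (φ : ↥(boxDom fun j => n * M j) → ℝ) (x : ↥(boxDom fun j => n * M j)) :
    opK n a m2 M (fun _ => c) φ x = 0 := by
  rw [opK_const]

/-- SANITY: a constant `h = c`, `|c| ≤ 1`, has sizes `(0, 0, 0)` — the size hypotheses are consistent and the
factor bound then reads `‖K_cG(cf)‖ ≤ 0`, in accordance with `K_c = 0`. [folklore] -/
example {c : ℝ} (hc : |c| ≤ 1) : HSize n M (fun _ => c) 0 0 0 :=
  ⟨le_rfl, le_rfl, le_rfl, fun _ => hc, fun x y _ => by simp, fun x => by simp, fun x y _ => by simp⟩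

/-- SANITY: the commutator is antisymmetric in the rôles of `hH` and `Hh` — for `φ = h`-multiples of constants
nothing special happens, but `K_h 1 = h·(H1) − H h` is MINUS the "free" action of `H − (m² + a)` on `h`:
`(K_h 1)(x) = (n²Σ_{y∼x}(h(y) − h(x))) + (a/n^{d+1})Σ_{B(x)}(h(x) − h(y))` (the Leibniz form with `φ = 1`).
[folklore] -/
example (h : ↥(boxDom fun j => n * M j) → ℝ) (x : ↥(boxDom fun j => n * M j)) :
    opK n a m2 M h (fun _ => 1) x
      = (n : ℝ) ^ 2 * ∑ y ∈ boxNbrs (fun j => n * M j) x, (h y - h x)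
        + a * ((n : ℝ) ^ (d + 1))⁻¹ * ∑ y ∈ boxBlk n (fun j => n * M j) x, (h x - h y) := by
  rw [opK_apply]
  simp

end Sanity

end

end Literature.MathematicalPhysics.QuantumFieldTheory.Balaban1983to89.B4Eq220CommutatorZeroBox
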